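import Literature.NumberTheory.Automorphic.ResGLnKugaHarmonic
import HarnessLib

/-!
# `Ad(G_∞)`-invariance of the canonical tensor of the trace form of `𝔤𝔩ₙ(K_∞)`

Topic `NumberTheory/Automorphic`; namespaces `Literature.NumberTheory.Automorphic.ResGLnCartan`
(sequel of `ResGLnCartanData`) and `…ConeDictionary` (sequel of `ResGLnKugaHarmonic`).  One
definition with body (`AdEquiv`, the adjoint action as a linear equivalence) and theorems; no named
fact, no `sorry`.

The hypothesis `hTK` of Wigner's lemma `GKTensor.casimir_scalar_eq_of_cohomology_ne_zero` (and of
`GKTensor.endoCohomologyHom_rTensor_op_eq_lTensor_op`) for the canonical tensor `∑_t b_t ⊗ b^t` of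
the real trace form `B(X, Y) = Re tr_{K_∞/ℝ}(XY)` over the adapted basis of `ResGLnCartanData`:

* `AdEquiv g : 𝔤 ≃ₗ[ℝ] 𝔤` — `Ad g` with inverse `Ad g⁻¹`;
* `trForm_Ad` — `B(Ad g X, Ad g Y) = B(X, Y)` (the trace is conjugation invariant);
* `sum_Ad_adaptedBasis_tmul_dualB` — `∑_t Ad g b_t ⊗ Ad g b^t = ∑_t b_t ⊗ b^t` for every
  `g ∈ G_∞` (`Literature.Algebra.Lie.sum_map_basis_tmul_dualBasis`);
* `ConeDictionary.kugaD_hTK` — the same for `k ∈ K_∞`, re-typed over the datum (`bD`, `dD`).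

[cite: BorelWallach2000, I §2.3, II §2.5]

## References

* A. Borel, N. Wallach, *Continuous cohomology, discrete subgroups, and representations of reductive
  groups*, 2nd ed. (2000), I §2.3, II §2.5 (held). [BorelWallach2000]
* A. W. Knapp, *Lie groups beyond an introduction*, 2nd ed. (2002), V §4. [Knapp2002]
-/

noncomputable section

namespace Literature.NumberTheory.Automorphic

-- Mathlib idiom (as in `GKModules`): commutator bracket on matrix algebras and `Module.End`
attribute [local instance 100] LieRing.ofAssociativeRing

-- `Classical`: the place subtypes indexing `mixedSpace K` are `Fintype` classically (as in `AdelicGLnGlue`).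
open scoped TensorProduct Classical _root_.Matrix MatrixGroups
open _root_.NumberField _root_.NumberField.mixedEmbedding RealMatrixGroup

namespace ResGLnCartan

variable (n : ℕ) (K : Type) [Field K] [NumberField K]

/-- `Ad g (Ad g⁻¹ X) = X`. [folklore] -/
theorem Ad_Ad_inv (g : (archGroupGL n K).carrier) (X : 𝔤 n K) :
    (archGroupGL n K).Ad g ((archGroupGL n K).Ad g⁻¹ X) = X := by
  ext : 1
  simp only [Ad_apply_coe, Subgroup.coe_inv, inv_inv, Matrix.mul_assoc, Units.mul_inv_cancel_left, Units.mul_inv,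
    Matrix.mul_one]

/-- `Ad g⁻¹ (Ad g X) = X`. [folklore] -/
theorem Ad_inv_Ad (g : (archGroupGL n K).carrier) (X : 𝔤 n K) :
    (archGroupGL n K).Ad g⁻¹ ((archGroupGL n K).Ad g X) = X := by
  simpa only [inv_inv] using Ad_Ad_inv n K g⁻¹ X

/-- **The adjoint action `Ad g` of `g ∈ G_∞` on `𝔤` as a linear equivalence** (inverse `Ad g⁻¹`).
[cite: Knapp2002, I §10 (1.83)] -/
def AdEquiv (g : (archGroupGL n K).carrier) : 𝔤 n K ≃ₗ[ℝ] 𝔤 n K :=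
  LinearEquiv.ofLinear ((archGroupGL n K).Ad g : 𝔤 n K →ₗ[ℝ] 𝔤 n K) ((archGroupGL n K).Ad g⁻¹ : 𝔤 n K →ₗ[ℝ] 𝔤 n K)
    (LinearMap.ext fun X => Ad_Ad_inv n K g X) (LinearMap.ext fun X => Ad_inv_Ad n K g X)

/-- Unfolding. [folklore] -/
@[simp] theorem AdEquiv_apply (g : (archGroupGL n K).carrier) (X : 𝔤 n K) :
    AdEquiv n K g X = (archGroupGL n K).Ad g X := rfl

/-- **`B` is `Ad`-invariant**: `B(Ad g X, Ad g Y) = B(X, Y)` (`tr(g XY g⁻¹) = tr(XY)`).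
[cite: Knapp2002, I §10, Prop. 1.89] -/
theorem trForm_Ad (g : (archGroupGL n K).carrier) (X Y : 𝔤 n K) :
    trForm n K ((archGroupGL n K).Ad g X) ((archGroupGL n K).Ad g Y) = trForm n K X Y := by
  rw [trForm_apply, trForm_apply, Ad_apply_coe, Ad_apply_coe]
  have e : (((g : (archGroupGL n K).carrier) : GL (Fin n) (mixedSpace K)) : Matrix (Fin n) (Fin n) (mixedSpace K)) * X *
        ((((g : (archGroupGL n K).carrier) : GL (Fin n) (mixedSpace K))⁻¹ : GL (Fin n) (mixedSpace K)) :
          Matrix (Fin n) (Fin n) (mixedSpace K)) *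
        ((((g : (archGroupGL n K).carrier) : GL (Fin n) (mixedSpace K)) : Matrix (Fin n) (Fin n) (mixedSpace K)) * Y *
          ((((g : (archGroupGL n K).carrier) : GL (Fin n) (mixedSpace K))⁻¹ : GL (Fin n) (mixedSpace K)) :
            Matrix (Fin n) (Fin n) (mixedSpace K))) =
      (((g : (archGroupGL n K).carrier) : GL (Fin n) (mixedSpace K)) : Matrix (Fin n) (Fin n) (mixedSpace K)) *
        (((X : Matrix (Fin n) (Fin n) (mixedSpace K)) * Y) *
          ((((g : (archGroupGL n K).carrier) : GL (Fin n) (mixedSpace K))⁻¹ : GL (Fin n) (mixedSpace K)) :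
            Matrix (Fin n) (Fin n) (mixedSpace K))) := by
    simp only [Matrix.mul_assoc, Units.inv_mul_cancel_left]
  rw [e, ← Matrix.mul_assoc, Matrix.trace_mul_cycle, Units.inv_mul, Matrix.one_mul]

/-- **The canonical tensor is `Ad(G_∞)`-invariant**: `∑_t Ad g b_t ⊗ Ad g b^t = ∑_t b_t ⊗ b^t`.
[cite: BorelWallach2000, I §2.3] -/
theorem sum_Ad_adaptedBasis_tmul_dualB (g : (archGroupGL n K).carrier) :
    ∑ t, (archGroupGL n K).Ad g (adaptedBasis n K t) ⊗ₜ[ℝ] (archGroupGL n K).Ad g (dualB n K t) =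
      ∑ t, adaptedBasis n K t ⊗ₜ[ℝ] dualB n K t :=
  Literature.Algebra.Lie.sum_map_basis_tmul_dualBasis trForm_nondegenerate trForm_isSymm (adaptedBasis n K) (AdEquiv n K g)
    (trForm_Ad n K g)

end ResGLnCartan

namespace ConeDictionary

variable (n : ℕ) (K : Type) [Field K] [NumberField K] (hcpt : isCompact_glFiniteIntegralLevel n K)

set_option maxHeartbeats 800000 in
-- one-time re-typing over the datum (definitional)
/-- **Hypothesis `hTK` over the datum**: the canonical tensor `∑_t b_t ⊗ b^t` is invariant under
`Ad(K_∞)` (indeed under `Ad(G_∞)`). [cite: BorelWallach2000, I §2.3, II §2.5] -/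
theorem kugaD_hTK (k : (AutomorphyDatum.gl n K hcpt).arch.maximalCompact) :
    ∑ t, (AutomorphyDatum.gl n K hcpt).arch.Ad
          (Subgroup.inclusion (AutomorphyDatum.gl n K hcpt).arch.maximalCompact_le_carrier k) (bD n K hcpt t) ⊗ₜ[ℝ]
        (AutomorphyDatum.gl n K hcpt).arch.Ad
          (Subgroup.inclusion (AutomorphyDatum.gl n K hcpt).arch.maximalCompact_le_carrier k) (dD n K hcpt t) =
      ∑ t, bD n K hcpt t ⊗ₜ[ℝ] dD n K hcpt t :=
  ResGLnCartan.sum_Ad_adaptedBasis_tmul_dualB n K (Subgroup.inclusion (archGroupGL n K).maximalCompact_le_carrier k)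

/-- **Hypothesis `hT` over the datum, for the adapted basis** (infinitesimal invariance of the
canonical tensor): `kugaD_hT` read through `Sum.elim x w = b`, `Sum.elim x w' = b^`. [folklore] -/
theorem kugaD_hT_bD (z : 𝔤D n K hcpt) :
    ∑ t, (⁅z, bD n K hcpt t⁆ ⊗ₜ[ℝ] dD n K hcpt t + bD n K hcpt t ⊗ₜ[ℝ] ⁅z, dD n K hcpt t⁆) =
      (0 : 𝔤D n K hcpt ⊗[ℝ] 𝔤D n K hcpt) := by
  rw [← sumElim_xD_wD, ← sumElim_xD_w'D]
  exact kugaD_hT n K hcpt z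

end ConeDictionary

end Literature.NumberTheory.Automorphic

end
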